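import Summits.AtomisticToContinuum.Crystallization.Theses.TwoCentreKissingKernel

/-!
# Birth skeleton for the crux `GapFreeShellRigidity` (route TwoCentreKissingKernel, item stmt-AtomisticToContinuum-12078)

Line **hales-gap** (registered as `Lines/birth.lean`): *the gap is free* — at tolerance
`η ≤ 10⁻³` the kernel's own hypothesis "every soft neighbour of `x` is EXACTLY twelve soft-coordinated"
already forces Hales's empty annulus around every shell point (soft form of the weighted Flyspeck
inequality `L12`, Hales 2012 Lemma 1 ⟹ Lemma 2), so the translated shell of `x` is a *gapped soft
kissing configuration* (twelve points, norms in `[1 − η, 1 + η]`, every pair either a soft contact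
`≤ 1 + η` or `≥ 63/50 − (2526/100) η` apart, `= 1.23474` at `η = 10⁻³`), and the conclusion is the
effective form of Hales 2012 Theorem 3 / Lemmas 9–10 (every kissing configuration of the class `𝒱`
is the FCC or the HCP pattern) at gap arc `76.16°` instead of `78.10°`, with the `O(√η)` jitterbug
drift (`≤ 0.060 < 1/10` at `10⁻³`) absorbed by the closeness constant `1/10`.

* `stub_softTwelveGap` (soft `L12` ⟹ soft Lemma 2; size M given the named fact
  `Literature.Geometry.DiscreteGeometry.flyspeck_L12`, XL unconditionally = the Flyspeck local annulus
  inequality, HOL-Light-verified): if `y ∈ S`, `S` is `(1 − η)`-separated on `B(y, 13/10)` and exactly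
  twelve points of `S ∖ {y}` lie within `1 + η` of `y`, then every other point of `S` is within `1 + η`
  of `y` or at distance `≥ 63/50 − (2526/100) η`.  (Thirteen points with pairwise distances `≥ 1 − η`,
  twelve of them at distance `≤ 1 + η` from `y` and one below the bound, rescaled by `2/(1 − η)`, have
  total Hales weight `∑ L(‖v‖/2) > 12 L((1+η)/(1−η)) + L((63/50 − 25.26 η)/(1 − η)) = 12`, contradicting
  `L12`; the constant is exactly what the weighted inequality yields.)
* `stub_gappedShellRigidity` (effective Hales 2012 Thm 3 + Lemmas 9–10, metric form; size XL,
  certificate technology): a twelve-point `T ⊂ ℝ³` with norms in `[1 − η, 1 + η]` whose pairwise distances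
  are all `≥ 1 − η` and each either `≤ 1 + η` or `≥ 63/50 − (2526/100) η` is `1/10`-close after a linear
  isometry to `fccKissingPattern` or to `hcpKissingPattern`.  At `η = 0` this is literally the class `𝒱`
  of Hales's Definition 1 (scaled by `1/2`) and the named facts `Hales2012_contactGraphTame` +
  the PROVED Lemma 10 `kissingConfigCongruent_of_contactGraphFccOrHcp` (KissingRigidity.lean).

`GapFreeShellRigidity_of` is the composition (real proof, no `sorry`): build the translated shell `T`
(twelve points by the hypothesis at `y = x`), read off norms and separation from the `(1 − η)`-separation
on `B(x, 4)`, get the gap dichotomy for each pair of shell points from `stub_softTwelveGap` applied AT THE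
SHELL POINT (its `13/10`-neighbourhood lies inside `B(x, 4)` and it is twelve-coordinated by hypothesis),
and conclude with `stub_gappedShellRigidity`.  Sorries live only in the two `stub_*` theorems.

The route's own glued split of this crux, `KernelGlue : SoftTwoCentreFourCommon → RobustTangencyBound →
GapFreeShellRigidity`, is already typed as items 12081 / 12082 with the glue 12083 PROVED
(`Theorems.kernelGlue_proof`); it needs no stub registration and stays available: when both items close,
`kernelGlue_proof h₁ h₂` closes the crux.  This line is the Conjecture-2.2-free alternative identified by
the crux-attack refuter (item evidence EVIDENCE.md, 2026-08-15): its `η = 0` section is a THEOREM in print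
(Flyspeck `L12` + Hales 2012), whereas `SoftTwoCentreFourCommon` at `η = 0` is Flatley–Theil's open
Conjecture 2.2 (four prover seats on 12081 returned `blocked-on 12077`).

Disproof.lean for this crux: none on file at registration (`ledger crux ls`: no workfiles); no
`_false_without_` obstruction to honour yet.  Negatives index checked: 15929 (`GappedShellCensus.ShellCensus`,
gapped twelve-shells at tolerance `1/50`, refuted by the torn icosahedron, which needs tolerance `≥ 1.77 %`)
and 4146 (`BrittleMieDescent.EffectiveLocalHales` at `1/100`, refuted by the decahedral `D₅ₕ` shell, which
needs `≥ 0.67 %`): `stub_gappedShellRigidity` sits at tolerance `0.1 %`, below both thresholds (crux-attack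
numerics on this item: smallest exotic gapped / contact-saturated shell at `η⋆ = 0.006687`).
-/

namespace Summit.AtomisticToContinuum.Crystallization.Cruxes.GapFreeShellRigidity.Birth

/-! ## §0 The two stub STATEMENTS as named propositions (namespace `Goal`; character for character the
signatures of the registered stubs of §1 — the composition takes them BY NAME) -/

namespace Goal

/-- Statement of `stub_softTwelveGap` (see §1). -/
def stub_softTwelveGap : Prop :=
  ∀ η : ℝ, 0 ≤ η → η ≤ 1 / 1000 → ∀ (S : Set (EuclideanSpace ℝ (Fin 3))) (y : EuclideanSpace ℝ (Fin 3)), y ∈ S → (∀ w ∈ S, ∀ w' ∈ S, dist y w ≤ 13 / 10 → dist y w' ≤ 13 / 10 → w ≠ w' → 1 - η ≤ dist w w') → {w ∈ S | w ≠ y ∧ dist y w ≤ 1 + η}.ncard = 12 → ∀ w ∈ S, w ≠ y → dist y w ≤ 1 + η ∨ 63 / 50 - 2526 / 100 * η ≤ dist y w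

/-- Statement of `stub_gappedShellRigidity` (see §1). -/
def stub_gappedShellRigidity : Prop :=
  ∀ η : ℝ, 0 ≤ η → η ≤ 1 / 1000 → ∀ T : Finset (EuclideanSpace ℝ (Fin 3)), T.card = 12 → (∀ y ∈ T, 1 - η ≤ ‖y‖ ∧ ‖y‖ ≤ 1 + η) → (∀ y ∈ T, ∀ y' ∈ T, y ≠ y' → 1 - η ≤ dist y y' ∧ (dist y y' ≤ 1 + η ∨ 63 / 50 - 2526 / 100 * η ≤ dist y y')) → Literature.Geometry.DiscreteGeometry.ShellCloseTo (1 / 10) T Literature.Geometry.DiscreteGeometry.fccKissingPattern ∨ Literature.Geometry.DiscreteGeometry.ShellCloseTo (1 / 10) T Literature.Geometry.DiscreteGeometry.hcpKissingPattern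

end Goal

/-! ## §1 Registered stubs (the ONLY `sorry`s of the file; signatures fully inlined and qualified) -/

/-- **Stub A — soft `L12` gap (Hales 2012 Lemma 2 made soft).**  `η ∈ [0, 10⁻³]`; `y ∈ S`; `S` is
`(1 − η)`-separated on the ball `B(y, 13/10)`; exactly twelve points of `S ∖ {y}` lie within `1 + η` of
`y`.  Then every `w ∈ S ∖ {y}` satisfies `dist y w ≤ 1 + η` or `63/50 − (2526/100) η ≤ dist y w` — an
empty annulus `(1 + η, 1.26 − 25.26 η)` around `y` (`(1.001, 1.23474)` at `η = 10⁻³`).  Why plausibly true: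
it follows from the weighted Flyspeck inequality `flyspeck_L12` (`∑ L(‖v‖/2) ≤ 12` for `2`-separated
points in the annulus `2 ≤ ‖v‖ ≤ 2.52`, `L(h) = (1.26 − h)/0.26`) applied to the thirteen points
`(2/(1−η)) (w − y)`: the twelve soft neighbours weigh `≥ L((1+η)/(1−η))` each and a thirteenth point below
the bound weighs `> L((63/50 − 25.26 η)/(1−η))`, total `> 12`.  At `η = 0` it is Hales's Lemma 2 verbatim
(gap `2h₀/2 = 1.26`).  Size M relative to the named fact `flyspeck_L12`; XL unconditionally (the Flyspeck
local annulus inequality, verified in HOL Light, `flyspeck_L12_iff_forall_localAnnulusInequality`).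
Sources: arXiv:1209.6043 Lemmas 1–2; arXiv:1501.02155 §4.2. -/
theorem stub_softTwelveGap :
    ∀ η : ℝ, 0 ≤ η → η ≤ 1 / 1000 → ∀ (S : Set (EuclideanSpace ℝ (Fin 3))) (y : EuclideanSpace ℝ (Fin 3)), y ∈ S → (∀ w ∈ S, ∀ w' ∈ S, dist y w ≤ 13 / 10 → dist y w' ≤ 13 / 10 → w ≠ w' → 1 - η ≤ dist w w') → {w ∈ S | w ≠ y ∧ dist y w ≤ 1 + η}.ncard = 12 → ∀ w ∈ S, w ≠ y → dist y w ≤ 1 + η ∨ 63 / 50 - 2526 / 100 * η ≤ dist y w := by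
  sorry

/-- **Stub B — gapped soft kissing configurations are FCC or HCP (effective Hales 2012 Theorem 3 +
Lemmas 9–10, metric form).**  `η ∈ [0, 10⁻³]`; `T ⊂ ℝ³` has twelve points with norms in `[1 − η, 1 + η]`;
every pair of distinct points is `≥ 1 − η` apart and EITHER a soft contact (`≤ 1 + η`) OR `≥ 63/50 −
(2526/100) η` apart.  Then `T` is `1/10`-close after a linear isometry (`ShellCloseTo (1/10)`) to the FCC
or to the HCP kissing pattern.  Why plausibly true: at `η = 0` the set `2 • T` is a kissing configuration
of Hales's class `𝒱` (Definition 1: distances `= 2` or `≥ 2h₀ = 2.52`) and the statement is Theorem 3 +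
Lemma 9 (named fact `Hales2012_contactGraphTame`, computer-assisted: main estimate, hypermap
classification, LP) + Lemma 10 (PROVED in tree: `kissingConfigCongruent_of_contactGraphFccOrHcp`,
KissingRigidity.lean); for `η ≤ 10⁻³` the gap arc is `2 arcsin(1.23474/2.002) = 76.16°` instead of
`78.10°`, the node-type / LP exclusions of Lemma 9 keep positive margins (crux-attack numerics on this
item: no exotic shell below `η⋆ = 0.006687`; the `(0,4)` node opens only at `η = 1.25·10⁻³`; graph-6
certificate margin `0.67°`), and the one infinitesimal flex of the centred (anti)cuboctahedron drifts the
24-contact shells by `≤ 0.0447` (FCC) / `0.0597` (HCP) `< 1/10` (LP-duality bound, kit j018667/j018673).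
Why it might fail: thin LP margins at `10⁻³`; an exotic gapped twelve-shell between `0.1 %` and the known
thresholds (decahedral `0.67 %`, torn icosahedra `≥ 1.5 %`, negatives 4146 / 15929) would have to appear
already at `0.1 %`.  Size XL (certificate technology: interval branch-and-bound / rational LP certificates
over Hales's node types at the soft parameters; the vendored Hales-2012 infrastructure
KissingNodeTypes / KissingCornerBounds / KissingLPTables / TameContactGraphs / KissingRigidity is the
`η = 0` template).  Sources: arXiv:1209.6043 Thm 3, Lemmas 9–10; doi:10.1016/j.cam.2013.03.036;
arXiv:1407.0692 §2.1. -/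
theorem stub_gappedShellRigidity :
    ∀ η : ℝ, 0 ≤ η → η ≤ 1 / 1000 → ∀ T : Finset (EuclideanSpace ℝ (Fin 3)), T.card = 12 → (∀ y ∈ T, 1 - η ≤ ‖y‖ ∧ ‖y‖ ≤ 1 + η) → (∀ y ∈ T, ∀ y' ∈ T, y ≠ y' → 1 - η ≤ dist y y' ∧ (dist y y' ≤ 1 + η ∨ 63 / 50 - 2526 / 100 * η ≤ dist y y')) → Literature.Geometry.DiscreteGeometry.ShellCloseTo (1 / 10) T Literature.Geometry.DiscreteGeometry.fccKissingPattern ∨ Literature.Geometry.DiscreteGeometry.ShellCloseTo (1 / 10) T Literature.Geometry.DiscreteGeometry.hcpKissingPattern := by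
  sorry

/-! ## §2 Composition (kernel-checked, no `sorry`): the stub statements imply the crux BY NAME -/

/-- **Composition: Stub A → Stub B → `GapFreeShellRigidity`** (hypotheses = the §0 statements by name,
definitionally the §1 signatures; conclusion = the route decl by name).  Given `η, S, x` as in the crux,
let `N` be the soft shell of `x` (twelve points, by the coordination hypothesis at `y = x`) and `T` its
translate by `−x`.  Norms of `T` lie in `[1 − η, 1 + η]` and distinct points of `T` are `≥ 1 − η` apart
(separation on `B(x, 4)`).  For shell points `y ≠ y'`, Stub A at the centre `y` — admissible because
`B(y, 13/10) ⊆ B(x, 4)` carries the separation and `y` is twelve-coordinated by hypothesis — gives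
`dist y y' ≤ 1 + η ∨ 63/50 − (2526/100) η ≤ dist y y'`; translation preserves distances, so `T` is a
gapped soft kissing configuration and Stub B yields the pattern alternative; `↑T` is the translated shell
by construction. -/
theorem GapFreeShellRigidity_of :
    Goal.stub_softTwelveGap → Goal.stub_gappedShellRigidity →
    Summit.AtomisticToContinuum.Crystallization.Theses.TwoCentreKissingKernel.GapFreeShellRigidity := by
  intro hGap hRig
  unfold Goal.stub_softTwelveGap at hGap
  unfold Goal.stub_gappedShellRigidity at hRig
  unfold Summit.AtomisticToContinuum.Crystallization.Theses.TwoCentreKissingKernel.GapFreeShellRigidity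
  intro η hη0 hη1 S x hx hsep h12
  -- the soft shell of `x`
  set N : Set (EuclideanSpace ℝ (Fin 3)) := {y ∈ S | y ≠ x ∧ dist x y ≤ 1 + η} with hN
  have hNcard : N.ncard = 12 := h12 x hx (by rw [dist_self]; linarith)
  have hNfin : N.Finite := Set.finite_of_ncard_ne_zero (by rw [hNcard]; norm_num)
  obtain ⟨T, hT⟩ : ∃ T : Finset (EuclideanSpace ℝ (Fin 3)),
      T = hNfin.toFinset.image (fun y => y - x) := ⟨_, rfl⟩
  have hmemT : ∀ t, t ∈ T ↔ ∃ y ∈ N, y - x = t := by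
    intro t
    simp only [hT, Finset.mem_image, Set.Finite.mem_toFinset]
  have hTcard : T.card = 12 := by
    rw [hT, Finset.card_image_of_injective _ sub_left_injective,
      ← Set.ncard_eq_toFinset_card N hNfin, hNcard]
  -- norms of the translated shell
  have hnorm : ∀ t ∈ T, 1 - η ≤ ‖t‖ ∧ ‖t‖ ≤ 1 + η := by
    intro t ht
    obtain ⟨y, ⟨hyS, hyx, hdy⟩, rfl⟩ := (hmemT t).1 ht
    rw [← dist_eq_norm, dist_comm]
    exact ⟨hsep x hx y hyS (by rw [dist_self]; norm_num) (by linarith) hyx.symm, hdy⟩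
  -- separation and the gap dichotomy inside the translated shell
  have hgapT : ∀ t ∈ T, ∀ t' ∈ T, t ≠ t' →
      1 - η ≤ dist t t' ∧ (dist t t' ≤ 1 + η ∨ 63 / 50 - 2526 / 100 * η ≤ dist t t') := by
    intro t ht t' ht' hne
    obtain ⟨y, ⟨hyS, hyx, hdy⟩, rfl⟩ := (hmemT t).1 ht
    obtain ⟨y', ⟨hy'S, hy'x, hdy'⟩, rfl⟩ := (hmemT t').1 ht'
    have hyy' : y ≠ y' := fun h => hne (by rw [h])
    rw [dist_sub_right]
    refine ⟨hsep y hyS y' hy'S (by linarith) (by linarith) hyy', ?_⟩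
    -- `(1 - η)`-separation on `B(y, 13/10) ⊆ B(x, 4)`
    have hsepy : ∀ w ∈ S, ∀ w' ∈ S, dist y w ≤ 13 / 10 → dist y w' ≤ 13 / 10 → w ≠ w' →
        1 - η ≤ dist w w' := by
      intro w hw w' hw' hdw hdw' hww'
      refine hsep w hw w' hw' ?_ ?_ hww'
      · calc dist x w ≤ dist x y + dist y w := dist_triangle x y w
          _ ≤ 4 := by linarith
      · calc dist x w' ≤ dist x y + dist y w' := dist_triangle x y w'
          _ ≤ 4 := by linarith
    -- `y` is exactly twelve soft-coordinated (a soft neighbour of `x`)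
    have h12y : {w ∈ S | w ≠ y ∧ dist y w ≤ 1 + η}.ncard = 12 := h12 y hyS hdy
    exact hGap η hη0 hη1 S y hyS hsepy h12y y' hy'S hyy'.symm
  refine ⟨T, ?_, hRig η hη0 hη1 T hTcard hnorm hgapT⟩
  rw [hT, Finset.coe_image, Set.Finite.coe_toFinset]

/-- **The registered skeleton in one line**: the two §1 stubs fed into `GapFreeShellRigidity_of` prove the
crux by name (the `Goal` statements unfold to the stub signatures; `#print axioms` reaches `sorryAx`
exactly through `stub_softTwelveGap` and `stub_gappedShellRigidity`). -/
theorem gapFreeShellRigidity_skeleton :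
    Summit.AtomisticToContinuum.Crystallization.Theses.TwoCentreKissingKernel.GapFreeShellRigidity :=
  GapFreeShellRigidity_of stub_softTwelveGap stub_gappedShellRigidity

end Summit.AtomisticToContinuum.Crystallization.Cruxes.GapFreeShellRigidity.Birth
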